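import Literature.NumberTheory.DiophantineGeometry.PlaneCurveFunctionFieldProofs
import Literature.NumberTheory.DiophantineGeometry.PlaneCurveRationalPlaceProofs
import Literature.NumberTheory.DiophantineGeometry.FunctionFieldSchmidtDegreeOneKummerProofs
import Literature.NumberTheory.DiophantineGeometry.FunctionFieldGenusEllZeroProofs
import Literature.NumberTheory.DiophantineGeometry.FunctionFieldGenusApproximationProofs
import HarnessLib

/-!
# Places of a plane curve centred at a nonsingular rational point

Library file of the function-field chain (`FunctionFieldDivisors`, …, `PlaneCurveFunctionFieldProofs`).
Let `F/K` be an algebraic function field of one variable generated by `x, y` with `Φ(x, y) = 0`,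
where `Φ ∈ K[X][Y]` generates the ideal of relations (`G(x, y) = 0 ⇒ Φ ∣ G`) and every element of
`F` is a quotient `G(x, y)/H(x, y)` — the situation of the function field `K(X)[Y]/(Φ)` of an
irreducible plane curve `Φ = 0` (`PlaneCurveFunctionFieldProofs`). Let `(a, b) ∈ K²` be a point of
the curve, `Φ(a, b) = 0`.

* `exists_place_of_derivative_ne_zero`: if `∂Φ/∂Y (a, b) ≠ 0` (and `x ≠ a`), there is a place `P`
  of `F/K` **centred at `(a, b)`** (`x, y ∈ 𝒪_P`, `x ≡ a`, `y ≡ b (mod P)`); it has **degree one**,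
  and it is the **only** place centred at `(a, b)`.

Proof (the classical one, cf. Fulton, *Algebraic Curves*, §3.2, or the proof of Kummer's theorem,
Stichtenoth Thm. 3.3.7): with `R = K[x, y] ⊆ F` and `𝔪 = (x - a, y - b)` the kernel of
`R → K`, `G(x, y) ↦ G(a, b)`, the local ring `R_𝔪 ⊆ F` is Noetherian with maximal ideal generated by
`x - a`: writing `Φ = (Y - b)Ψ + Φ(X, b)` and `Φ(X, b) = (X - a)Θ` one has `Ψ(a, b) = ∂Φ/∂Y(a, b) ≠ 0`,
so `y - b = -(x - a)Θ(x)/Ψ(x, y) ∈ (x - a)R_𝔪`. Hence `R_𝔪` is a discrete valuation ring of `F` with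
residue field `R/𝔪 = K` (`mem_or_inv_mem_of_maximalIdeal_eq_span` of the Kummer file), i.e. a place of
degree one centred at `(a, b)`; any place `Q` centred at `(a, b)` contains `R_𝔪`, and a proper
valuation ring containing a discrete valuation ring equals it.

The symmetric statement for `∂Φ/∂X (a, b) ≠ 0` follows by exchanging the variables
(`exists_place_of_derivative_swap_ne_zero`). In the model `L = K(X)[Y]/(Φ)` of
`PlaneCurveFunctionFieldProofs` (`Φ` monic in `Y`, `y = pb.gen` with minimal polynomial `Φ` over
`K(X)`) the two structural hypotheses hold (`dvd_of_evalEval_eq_zero`, by Gauss's lemma;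
`exists_mul_evalEval_eq`, by clearing denominators), whence `exists_place_of_nonsingular`: at a
rational point of the curve where `∂Φ/∂Y` or `∂Φ/∂X` does not vanish there is exactly one place, and
it is rational. These are the local inputs of the comparison between rational points of a (possibly
singular) plane curve and rational places of its function field (Weil's estimate for singular
curves, Cafure–Matera 2006 Lemma 5.1 / Aubry–Perret 1996).

## References

* W. Fulton, *Algebraic Curves*, 3rd ed. 2008, §3.2 (the local ring at a simple point is a DVR).
  [Fulton2008]
* H. Stichtenoth, *Algebraic Function Fields and Codes*, 2nd ed., GTM 254, Springer 2009, Thm. 1.1.6,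
  Thm. 3.3.7 (proof). [Stichtenoth2009]
* A. Cafure, G. Matera, Finite Fields Appl. 12 (2006) 155–185, Lemma 5.1. [CafureMatera2006]
-/

noncomputable section

open scoped Classical Polynomial.Bivariate
open Polynomial

namespace Literature.NumberTheory.DiophantineGeometry.AlgFunctionField

universe u v

variable {K : Type u} {F : Type v} [Field K] [Field F] [Algebra K F]

/-! ### Bivariate Taylor splitting at a point -/

/-- `Φ = (Y - b) · (Φ / (Y - b)) + Φ(X, b)` in `K[X][Y]`. [folklore] -/
theorem eq_Y_sub_C_mul_add_C_eval (Φ : K[X][Y]) (b : K) :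
    Φ = (X - C (C b)) * (Φ /ₘ (X - C (C b))) + C (Φ.eval (C b)) := by
  have h1 := modByMonic_add_div Φ (X - C (C b))
  rw [modByMonic_X_sub_C_eq_C_eval] at h1
  exact h1.symm.trans (add_comm _ _)

/-- `p = (X - a) · (p / (X - a)) + p(a)` in `K[X]`. [folklore] -/
theorem eq_X_sub_C_mul_add_C_eval (p : K[X]) (a : K) :
    p = (X - C a) * (p /ₘ (X - C a)) + C (p.eval a) := by
  have h1 := modByMonic_add_div p (X - C a)
  rw [modByMonic_X_sub_C_eq_C_eval] at h1
  exact h1.symm.trans (add_comm _ _)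

/-- The value at `(a, b)` of the quotient `Φ / (Y - b)` is `∂Φ/∂Y (a, b)`. [folklore] -/
theorem evalEval_divByMonic_Y_sub_C (Φ : K[X][Y]) (a b : K) :
    (Φ /ₘ (X - C (C b))).evalEval a b = (derivative Φ).evalEval a b := by
  conv_rhs => rw [eq_Y_sub_C_mul_add_C_eval Φ b]
  simp only [derivative_add, derivative_mul, derivative_sub, derivative_X, derivative_C, sub_zero,
    one_mul, add_zero, evalEval_add, evalEval_mul, evalEval_sub, evalEval_X, evalEval_C, eval_C,
    sub_self, zero_mul]

/-- A polynomial vanishing at `(a, b)` lies in the ideal `(X - a, Y - b)`: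
`G = (Y - b) G₁ + (X - a) G₂`. [folklore] -/
theorem exists_eq_of_evalEval_eq_zero {G : K[X][Y]} {a b : K} (hG : G.evalEval a b = 0) :
    ∃ G₁ : K[X][Y], ∃ G₂ : K[X], G = (X - C (C b)) * G₁ + C ((X - C a) * G₂) := by
  refine ⟨G /ₘ (X - C (C b)), (G.eval (C b)) /ₘ (X - C a), ?_⟩
  have h1 := eq_Y_sub_C_mul_add_C_eval G b
  have h2 := eq_X_sub_C_mul_add_C_eval (G.eval (C b)) a
  have h3 : (G.eval (C b)).eval a = 0 := hG
  rw [h3, map_zero, add_zero] at h2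
  rw [← h2]
  exact h1

/-! ### Evaluation maps -/

/-- The evaluation `G ↦ G(x, y)` of `K[X][Y]` in a `K`-algebra, written with `Polynomial.map` and
`evalEval`, is Mathlib's `aevalAeval`. [folklore] -/
theorem evalEval_map_eq_aevalAeval {A : Type*} [CommRing A] [Algebra K A] (x y : A)
    (G : K[X][Y]) : (G.map (mapRingHom (algebraMap K A))).evalEval x y = aevalAeval x y G := by
  have h : (evalEvalRingHom x y).comp (mapRingHom (mapRingHom (algebraMap K A))) =
      (aevalAeval x y : K[X][Y] →ₐ[K] A).toRingHom := by
    refine Polynomial.ringHom_ext (fun q => ?_) ?_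
    · rw [RingHom.comp_apply, coe_mapRingHom, Polynomial.map_C, coe_evalEvalRingHom, evalEval_C,
        coe_mapRingHom, eval_map, ← aeval_def]
      exact (aevalAeval_C x y q).symm
    · rw [RingHom.comp_apply, coe_mapRingHom, Polynomial.map_X, coe_evalEvalRingHom, evalEval_X]
      exact (aevalAeval_Y x y).symm
  exact congr($h G)

/-- Evaluating the polynomial with exchanged variables: `(swap G)(y, x) = G(x, y)` in any
`K`-algebra. [folklore] -/
theorem evalEval_map_swap {A : Type*} [CommRing A] [Algebra K A] (x y : A) (G : K[X][Y]) :
    ((Bivariate.swap G).map (mapRingHom (algebraMap K A))).evalEval y x =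
      (G.map (mapRingHom (algebraMap K A))).evalEval x y := by
  rw [evalEval_map_eq_aevalAeval, evalEval_map_eq_aevalAeval, Bivariate.aevalAeval_swap]

/-- `(swap G)(b, a) = G(a, b)` over `K` itself. [folklore] -/
theorem evalEval_swap_eq (G : K[X][Y]) (a b : K) :
    (Bivariate.swap G).evalEval b a = G.evalEval a b := by
  rw [← coe_aevalAeval_eq_evalEval, ← coe_aevalAeval_eq_evalEval, Bivariate.aevalAeval_swap]

/-! ### The place at a point with `∂Φ/∂Y ≠ 0` -/

/-- **The place of a plane curve centred at a point with `∂Φ/∂Y(a, b) ≠ 0`.** Let `F/K` be an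
algebraic function field of one variable, `x, y ∈ F` and `Φ ∈ K[X][Y]` with `Φ(x, y) = 0` such that
`Φ` divides every `G ∈ K[X][Y]` with `G(x, y) = 0` and every element of `F` is a quotient
`G(x, y)/H(x, y)`. Let `(a, b) ∈ K²` with `Φ(a, b) = 0`, `∂Φ/∂Y (a, b) ≠ 0` and `x ≠ a`. Then there is
a place `P` of `F/K` of degree one with `x, y ∈ 𝒪_P`, `v_P(x - a) > 0`, `v_P(y - b) > 0`, and every
place `Q` with these properties equals `P` (the local ring `K[x, y]_{(x-a, y-b)}` is a discrete
valuation ring of `F` with uniformizer `x - a` and residue field `K`).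
[cite: Fulton2008, §3.2] [cite: Stichtenoth2009, Thm. 3.3.7 (proof)] -/
theorem exists_place_of_derivative_ne_zero [IsAlgFunctionField K F] {x y : F} {Φ : K[X][Y]}
    (hΦ : (Φ.map (mapRingHom (algebraMap K F))).evalEval x y = 0)
    (hker : ∀ G : K[X][Y], (G.map (mapRingHom (algebraMap K F))).evalEval x y = 0 → Φ ∣ G)
    (hfrac : ∀ z : F, ∃ G H : K[X][Y], (H.map (mapRingHom (algebraMap K F))).evalEval x y ≠ 0 ∧
      z * (H.map (mapRingHom (algebraMap K F))).evalEval x y =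
        (G.map (mapRingHom (algebraMap K F))).evalEval x y)
    {a b : K} (hxa : x ≠ algebraMap K F a) (hab : Φ.evalEval a b = 0)
    (hder : (derivative Φ).evalEval a b ≠ 0) :
    ∃ P : PlaceOver K F, P.degree = 1 ∧ x ∈ P.toValuationSubring ∧ y ∈ P.toValuationSubring ∧
      P.valuation (x - algebraMap K F a) < 1 ∧ P.valuation (y - algebraMap K F b) < 1 ∧
      ∀ Q : PlaceOver K F, x ∈ Q.toValuationSubring → y ∈ Q.toValuationSubring →
        Q.valuation (x - algebraMap K F a) < 1 → Q.valuation (y - algebraMap K F b) < 1 → Q = P := by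
  classical
  -- ### the evaluation `e : K[X][Y] → F` at `(x, y)` and the ring `R = K[x, y] ⊆ F`
  set ι : K →+* F := algebraMap K F with hι
  set e : K[X][Y] →+* F := (evalEvalRingHom x y).comp (mapRingHom (mapRingHom ι)) with he
  have he_apply : ∀ G, e G = (G.map (mapRingHom ι)).evalEval x y := fun G => rfl
  have he_C : ∀ p : K[X], e (C p) = (p.map ι).eval x := fun p => by
    rw [he_apply, Polynomial.map_C, evalEval_C, coe_mapRingHom]
  have he_CC : ∀ c : K, e (C (C c)) = ι c := fun c => by rw [he_C, Polynomial.map_C, eval_C]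
  have he_CX : e (C X) = x := by rw [he_C, Polynomial.map_X, eval_X]
  have he_Y : e (X : K[X][Y]) = y := by rw [he_apply, Polynomial.map_X, evalEval_X]
  have he_xa : e (C (X - C a)) = x - ι a := by
    rw [he_C, Polynomial.map_sub, Polynomial.map_X, Polynomial.map_C, eval_sub, eval_X, eval_C]
  have he_yb : e (X - C (C b)) = y - ι b := by rw [map_sub, he_Y, he_CC]
  have hxa0 : x - ι a ≠ 0 := sub_ne_zero.2 hxa
  set R : Subring F := e.range with hR
  set eR : K[X][Y] →+* R := e.rangeRestrict with heR
  have heR_apply : ∀ p, ((eR p : R) : F) = e p := fun p => rfl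
  have heR_surj : Function.Surjective eR := e.rangeRestrict_surjective
  -- ### evaluation at `(a, b)` kills `Ker e`; the ideal `𝔭 = (x - a, y - b)` of `R`
  set ρ : K[X][Y] →+* K := evalEvalRingHom a b with hρ
  have hρ_apply : ∀ G, ρ G = G.evalEval a b := fun G => rfl
  have hkerle : RingHom.ker eR ≤ RingHom.ker ρ := by
    intro p hp
    rw [RingHom.mem_ker] at hp ⊢
    have hp' : e p = 0 := by rw [← heR_apply, hp]; rfl
    obtain ⟨q, rfl⟩ := hker p hp'
    rw [map_mul, hρ_apply Φ, hab, zero_mul]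
  set φ : R →+* K := eR.liftOfSurjective heR_surj ⟨ρ, hkerle⟩ with hφ
  have hφ_apply : ∀ p, φ (eR p) = ρ p := fun p =>
    eR.liftOfSurjective_comp_apply heR_surj ⟨ρ, hkerle⟩ p
  set 𝔭 : Ideal R := RingHom.ker φ with h𝔭
  haveI h𝔭p : 𝔭.IsPrime := RingHom.ker_isPrime φ
  have hmemker : ∀ z : R, z ∈ 𝔭 ↔ φ z = 0 := fun z => RingHom.mem_ker
  have hmem𝔭 : ∀ p, eR p ∈ 𝔭 ↔ p.evalEval a b = 0 := fun p => by rw [hmemker, hφ_apply, hρ_apply]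
  -- every `r ∈ R` is congruent to the constant `φ r` modulo `𝔭`
  have hsub𝔭 : ∀ r : R, r - eR (C (C (φ r))) ∈ 𝔭 := fun r => by
    obtain ⟨p, rfl⟩ := heR_surj r
    rw [← map_sub, hmem𝔭, evalEval_sub, hφ_apply, hρ_apply, evalEval_CC, sub_self]
  -- ### the local ring `L = R_𝔭 ⊆ F`
  set L : Subring F := (LocalSubring.ofPrime R 𝔭).toSubring with hL
  have hRL : R ≤ L := LocalSubring.le_ofPrime R 𝔭
  have halg : ∀ r : R, ((algebraMap R L r : L) : F) = (r : F) := fun r => rfl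
  haveI : IsNoetherianRing R := isNoetherianRing_of_surjective _ R eR heR_surj
  haveI : IsNoetherianRing L := IsLocalization.isNoetherianRing 𝔭.primeCompl L inferInstance
  -- the uniformizer `ϖ = x - a` in `L`
  set ϖL : L := algebraMap R L (eR (C (X - C a))) with hϖL
  have hϖL_coe : ((ϖL : L) : F) = x - ι a := by rw [hϖL, halg, heR_apply, he_xa]
  have hϖL0 : ϖL ≠ 0 := by
    intro h
    have : ((ϖL : L) : F) = 0 := by rw [h]; rfl
    exact hxa0 (hϖL_coe ▸ this)
  have hϖR_mem : eR (C (X - C a)) ∈ 𝔭 := by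
    rw [hmem𝔭, evalEval_C, eval_sub, eval_X, eval_C, sub_self]
  have hϖL_mem : ϖL ∈ IsLocalRing.maximalIdeal L :=
    (IsLocalization.AtPrime.to_map_mem_maximal_iff L 𝔭 _).mpr hϖR_mem
  have hϖL_not_unit : ¬ IsUnit ϖL := (IsLocalRing.mem_maximalIdeal _).mp hϖL_mem
  -- ### key step: `y - b ∈ ϖ L`
  set Ψ : K[X][Y] := Φ /ₘ (X - C (C b)) with hΨ
  set Θ : K[X] := (Φ.eval (C b)) /ₘ (X - C a) with hΘ
  have hΦ_split : Φ = (X - C (C b)) * Ψ + C ((X - C a) * Θ) := by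
    have h1 := eq_Y_sub_C_mul_add_C_eval Φ b
    have h2 := eq_X_sub_C_mul_add_C_eval (Φ.eval (C b)) a
    have h3 : (Φ.eval (C b)).eval a = 0 := hab
    rw [h3, map_zero, add_zero] at h2
    rw [← h2]
    exact h1
  have hΨ_not_mem : eR Ψ ∉ 𝔭 := by
    rw [hmem𝔭, hΨ, evalEval_divByMonic_Y_sub_C]
    exact hder
  obtain ⟨u, hu⟩ := IsLocalization.map_units L (⟨eR Ψ, hΨ_not_mem⟩ : 𝔭.primeCompl)
  have hyb_L : algebraMap R L (eR (X - C (C b))) ∈ Ideal.span {ϖL} := by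
    have h2 : eR Φ = 0 := Subtype.ext (by rw [heR_apply, he_apply, hΦ]; rfl)
    rw [hΦ_split, C_mul] at h2
    simp only [map_add, map_mul] at h2
    have h3 : eR (X - C (C b)) * eR Ψ = -(eR (C (X - C a)) * eR (C Θ)) :=
      eq_neg_of_add_eq_zero_left h2
    have h4 := congrArg (algebraMap R L) h3
    rw [map_mul, map_neg, map_mul] at h4
    have h5 : algebraMap R L (eR (X - C (C b))) =
        -(ϖL * algebraMap R L (eR (C Θ))) * ↑u⁻¹ := by
      rw [hϖL, ← h4, ← hu, mul_assoc, Units.mul_inv, mul_one]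
    rw [h5]
    exact Ideal.mul_mem_right _ _ (Submodule.neg_mem _
      (Ideal.mul_mem_right _ _ (Ideal.mem_span_singleton_self _)))
  -- ### the maximal ideal of `L` is `ϖ L`
  have h𝔭_span : ∀ r ∈ 𝔭, algebraMap R L r ∈ Ideal.span {ϖL} := by
    intro r hr
    obtain ⟨p, rfl⟩ := heR_surj r
    obtain ⟨p₁, p₂, hp⟩ := exists_eq_of_evalEval_eq_zero ((hmem𝔭 p).mp hr)
    rw [hp, C_mul]
    simp only [map_add, map_mul]
    exact Ideal.add_mem _ (Ideal.mul_mem_right _ _ hyb_L)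
      (Ideal.mul_mem_right _ _ (Ideal.mem_span_singleton_self _))
  have hmaxL : IsLocalRing.maximalIdeal L = Ideal.span {ϖL} := by
    apply le_antisymm
    · intro m hm
      obtain ⟨r, s, rfl⟩ := IsLocalization.exists_mk'_eq 𝔭.primeCompl m
      have hr : r ∈ 𝔭 := (IsLocalization.AtPrime.mk'_mem_maximal_iff L 𝔭 r s).mp hm
      rw [IsLocalization.mk'_eq_mul_mk'_one]
      exact Ideal.mul_mem_right _ _ (h𝔭_span r hr)
    · rw [Ideal.span_le, Set.singleton_subset_iff]; exact hϖL_mem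
  -- ### every element of `F` is a quotient of elements of `R ⊆ L`
  have hfracL : ∀ z : F, ∃ v w : L, z = v / w := by
    intro z
    obtain ⟨G, H, hH, hz⟩ := hfrac z
    refine ⟨⟨e G, hRL ⟨G, rfl⟩⟩, ⟨e H, hRL ⟨H, rfl⟩⟩, ?_⟩
    change z = e G / e H
    rw [he_apply, he_apply, eq_div_iff hH]
    exact hz
  -- ### `L` is a valuation ring `V` of `F`, a place of degree one
  have hmem_or : ∀ z : F, z ∈ L ∨ z⁻¹ ∈ L :=
    mem_or_inv_mem_of_maximalIdeal_eq_span L hϖL0 hmaxL hfracL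
  let V : ValuationSubring F := { L with mem_or_inv_mem' := hmem_or }
  have hVL : ∀ z : F, z ∈ V ↔ z ∈ L := fun z => Iff.rfl
  have hunitL : ∀ w : L, ((ϖL : L) : F) * (w : F) = 1 → False := fun w hw =>
    hϖL_not_unit (IsUnit.of_mul_eq_one w (Subtype.ext hw))
  have hVtop : V ≠ ⊤ := by
    intro hV
    have hinv : (x - ι a)⁻¹ ∈ L := (hVL _).mp (hV ▸ ValuationSubring.mem_top _)
    exact hunitL ⟨_, hinv⟩ (by rw [hϖL_coe]; exact mul_inv_cancel₀ hxa0)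
  have hKV : ∀ c : K, algebraMap K F c ∈ V := fun c =>
    (hVL _).mpr (hRL ⟨C (C c), he_CC c⟩)
  have hRV : ∀ p : K[X][Y], e p ∈ V := fun p => (hVL _).mpr (hRL ⟨p, rfl⟩)
  -- nonunits of `V` among elements of `L`
  have hval_lt : ∀ (z : F) (hz : z ∈ L), (⟨z, hz⟩ : L) ∈ IsLocalRing.maximalIdeal L →
      V.valuation z < 1 := by
    intro z hz hmax
    rw [← ValuationSubring.mem_nonunits_iff, ValuationSubring.mem_nonunits_iff_exists_mem_maximalIdeal]
    exact ⟨hz, hmax⟩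
  have hval_𝔭 : ∀ r : R, r ∈ 𝔭 → V.valuation (r : F) < 1 := fun r hr =>
    hval_lt _ (hRL r.2) (by
      have := (IsLocalization.AtPrime.to_map_mem_maximal_iff L 𝔭 r).mpr hr
      exact this)
  have hlt_max : ∀ (z : F) (hz : z ∈ L), V.valuation z < 1 →
      (⟨z, hz⟩ : L) ∈ IsLocalRing.maximalIdeal L := by
    intro z hz h
    obtain ⟨hz', h'⟩ := (ValuationSubring.mem_nonunits_iff_exists_mem_maximalIdeal (A := V)).1
      ((ValuationSubring.mem_nonunits_iff (A := V)).2 h)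
    exact h'
  have hR_V : ∀ r : R, (r : F) ∈ V := fun r => (hVL _).mpr (hRL r.2)
  -- the place `P` with valuation ring `V` (a DVR since `F/K` is a function field)
  clear_value V
  obtain ⟨P, rfl⟩ : ∃ P : PlaceOver K F, P.toValuationSubring = V :=
    ⟨{ toValuationSubring := V
       ne_top := hVtop
       isDVR := IsAlgFunctionField.isDiscreteValuationRing_of_ne_top_of_algebraMap_mem (K := K) V
         hVtop hKV
       algebraMap_mem := hKV }, rfl⟩
  -- ### residues: every element of `𝒪_P` reduces to a constant, so `deg P = 1`
  have hmaxV : ∀ z : P.toValuationSubring, P.valuation (z : F) < 1 →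
      z ∈ IsLocalRing.maximalIdeal P.toValuationSubring := by
    intro z hz
    obtain ⟨hz', h⟩ :=
      (ValuationSubring.mem_nonunits_iff_exists_mem_maximalIdeal (A := P.toValuationSubring)).1
        ((ValuationSubring.mem_nonunits_iff (A := P.toValuationSubring)).2 hz)
    exact h
  have hres_eq : ∀ (z : P.toValuationSubring) (c : K), P.valuation ((z : F) - ι c) < 1 →
      IsLocalRing.residue P.toValuationSubring z = algebraMap K P.residueField c := by
    intro z c hzc
    rw [PlaceOver.algebraMap_residueField_apply, ← sub_eq_zero, ← map_sub,
      IsLocalRing.residue_eq_zero_iff]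
    exact hmaxV _ hzc
  have hres_R : ∀ r : R, IsLocalRing.residue P.toValuationSubring ⟨(r : F), hR_V r⟩ =
      algebraMap K P.residueField (φ r) := by
    intro r
    apply hres_eq
    have h1 := hval_𝔭 _ (hsub𝔭 r)
    have h2 : (((r - eR (C (C (φ r))) : R) : F)) = (r : F) - ι (φ r) := by
      change (r : F) - ((eR (C (C (φ r))) : R) : F) = _
      rw [heR_apply, he_CC]
    rwa [h2] at h1
  have hres : ∀ z : P.toValuationSubring, ∃ c : K,
      IsLocalRing.residue P.toValuationSubring z = algebraMap K P.residueField c := by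
    intro z
    obtain ⟨r, s, hrs⟩ := IsLocalization.exists_mk'_eq 𝔭.primeCompl (⟨(z : F), (hVL _).1 z.2⟩ : L)
    have hs : (s : R) ∉ 𝔭 := s.2
    have hφs : φ s ≠ 0 := fun h => hs ((hmemker _).mpr h)
    -- `z * s = r` in `F`, hence in `V`
    have hzs : (z : F) * ((s : R) : F) = ((r : R) : F) := by
      have h1 := IsLocalization.mk'_spec L r s
      rw [hrs] at h1
      exact congrArg (fun t : L => (t : F)) h1
    have hzsV : z * ⟨((s : R) : F), hR_V _⟩ = ⟨((r : R) : F), hR_V _⟩ := Subtype.ext hzs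
    have h2 := congrArg (IsLocalRing.residue P.toValuationSubring) hzsV
    rw [map_mul, hres_R, hres_R] at h2
    refine ⟨φ r / φ s, ?_⟩
    have hφs' : algebraMap K P.residueField (φ s) ≠ 0 := by
      rw [map_ne_zero_iff _ (algebraMap K P.residueField).injective]; exact hφs
    rw [map_div₀, eq_div_iff hφs', h2]
  have hdeg : P.degree = 1 := by
    change Module.finrank K P.residueField = 1
    rw [finrank_eq_one_iff_of_nonzero' (1 : P.residueField) one_ne_zero]
    intro w
    obtain ⟨z, rfl⟩ := IsLocalRing.residue_surjective (R := P.toValuationSubring) w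
    obtain ⟨c, hc⟩ := hres z
    exact ⟨c, by rw [hc, Algebra.smul_def, mul_one]⟩
  -- ### `P` is centred at `(a, b)`
  have hxV : x ∈ P.toValuationSubring := he_CX ▸ hRV (C X)
  have hyV : y ∈ P.toValuationSubring := he_Y ▸ hRV X
  have hvx : P.valuation (x - ι a) < 1 := by
    have h := hval_𝔭 _ hϖR_mem
    rwa [heR_apply, he_xa] at h
  have hyb_mem : eR (X - C (C b)) ∈ 𝔭 := by
    rw [hmem𝔭, evalEval_sub, evalEval_X, evalEval_CC, sub_self]
  have hvy : P.valuation (y - ι b) < 1 := by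
    have h := hval_𝔭 _ hyb_mem
    rwa [heR_apply, he_yb] at h
  refine ⟨P, hdeg, hxV, hyV, hvx, hvy, ?_⟩
  -- ### uniqueness: a place centred at `(a, b)` contains `L`, hence equals `V`
  intro Q hxQ hyQ hQx hQy
  set O := Q.toValuationSubring with hO
  -- `R ⊆ O`
  have he_mem : ∀ p : K[X][Y], e p ∈ O := by
    intro p
    have h := map_evalEval_map_mapRingHom (algebraMap K O) (algebraMap O F) p ⟨x, hxQ⟩ ⟨y, hyQ⟩
    rw [← IsScalarTower.algebraMap_eq K O F] at h
    have h' : e p =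
        algebraMap O F ((p.map (mapRingHom (algebraMap K O))).evalEval ⟨x, hxQ⟩ ⟨y, hyQ⟩) := by
      rw [h]; rfl
    rw [h']
    exact Subtype.mem _
  have hR_O : ∀ r : R, (r : F) ∈ O := by
    intro r
    obtain ⟨p, hp⟩ := heR_surj r
    rw [← hp, heR_apply]
    exact he_mem p
  -- `𝔭` consists of elements of valuation `< 1` at `Q`
  have hQ𝔭 : ∀ r : R, r ∈ 𝔭 → Q.valuation (r : F) < 1 := by
    intro r hr
    obtain ⟨p, rfl⟩ := heR_surj r
    obtain ⟨p₁, p₂, hp⟩ := exists_eq_of_evalEval_eq_zero ((hmem𝔭 p).mp hr)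
    rw [heR_apply, hp]
    simp only [map_add, map_mul, he_yb, he_xa]
    refine Valuation.map_add_lt _ ?_ ?_
    · rw [Valuation.map_mul]
      calc Q.valuation (y - ι b) * Q.valuation (e p₁) ≤ Q.valuation (y - ι b) :=
            mul_le_of_le_one_right' ((O.valuation_le_one_iff _).2 (he_mem p₁))
        _ < 1 := hQy
    · rw [Valuation.map_mul]
      calc Q.valuation (x - ι a) * Q.valuation (e (C p₂)) ≤ Q.valuation (x - ι a) :=
            mul_le_of_le_one_right' ((O.valuation_le_one_iff _).2 (he_mem _))
        _ < 1 := hQx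
  -- elements of `R ∖ 𝔭` are units of `O`
  have hQunit : ∀ s : R, s ∉ 𝔭 → Q.valuation (s : F) = 1 := by
    intro s hs
    have hφs : φ s ≠ 0 := fun h => hs ((hmemker _).mpr h)
    have h1 : Q.valuation (((s - eR (C (C (φ s))) : R) : F)) < 1 := hQ𝔭 _ (hsub𝔭 s)
    have h1' : (((s - eR (C (C (φ s))) : R) : F)) = (s : F) - ι (φ s) := by
      change (s : F) - ((eR (C (C (φ s))) : R) : F) = _
      rw [heR_apply, he_CC]
    rw [h1'] at h1
    have h2 : Q.valuation (ι (φ s)) = 1 := by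
      have h3 := (O.valuation_eq_one_iff _).1 (Q.isUnit_algebraMap_toValuationSubring hφs)
      rwa [PlaceOver.algebraMap_toValuationSubring_apply] at h3
    have h4 : Q.valuation ((s : F) - ι (φ s)) < Q.valuation (ι (φ s)) := by rw [h2]; exact h1
    have h3 : (s : F) = ((s : F) - ι (φ s)) + ι (φ s) := by ring
    rw [h3, Valuation.map_add_eq_of_lt_right _ h4, h2]
  -- `L ⊆ O`
  have hL_O : ∀ z : F, z ∈ L → z ∈ O := by
    intro z hz
    obtain ⟨r, s, hrs⟩ := IsLocalization.exists_mk'_eq 𝔭.primeCompl (⟨z, hz⟩ : L)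
    have hzs : z * ((s : R) : F) = ((r : R) : F) := by
      have h1 := IsLocalization.mk'_spec L r s
      rw [hrs] at h1
      exact congrArg (fun t : L => (t : F)) h1
    rw [← O.valuation_le_one_iff]
    have h2 := congrArg Q.valuation hzs
    rw [Valuation.map_mul, hQunit _ s.2, mul_one] at h2
    rw [hO] at hR_O
    change Q.valuation z ≤ 1
    rw [h2]
    exact (O.valuation_le_one_iff _).2 (hR_O r)
  -- `O ⊆ V`: otherwise `ϖ⁻¹ ∈ O`
  have hO_V : ∀ z : F, z ∈ O → z ∈ P.toValuationSubring := by
    intro z hzO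
    by_contra hzV
    have hz0 : z ≠ 0 := by rintro rfl; exact hzV (zero_mem _)
    have hzinvL : z⁻¹ ∈ L := ((hmem_or z).resolve_left fun h => hzV ((hVL z).2 h))
    have hzinv : z⁻¹ ∈ P.toValuationSubring := (hVL _).2 hzinvL
    have hzinv_lt : P.valuation z⁻¹ < 1 := by
      rw [map_inv₀]
      have h1 : 1 < P.valuation z := by
        rw [← not_le]
        intro hle
        exact hzV ((P.toValuationSubring.valuation_le_one_iff _).1 hle)
      exact inv_lt_one_of_one_lt₀ h1
    have hmax : (⟨z⁻¹, hzinvL⟩ : L) ∈ IsLocalRing.maximalIdeal L := hlt_max _ hzinvL hzinv_lt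
    rw [hmaxL, Ideal.mem_span_singleton'] at hmax
    obtain ⟨w, hw⟩ := hmax
    have hw' : (w : F) * (x - ι a) = z⁻¹ := by
      have := congrArg (fun t : L => (t : F)) hw
      simpa [hϖL_coe] using this
    -- `ϖ⁻¹ = z w ∈ O`
    have hϖinv : (x - ι a)⁻¹ = z * (w : F) := by
      have h1 : z * (w : F) * (x - ι a) = 1 := by
        rw [mul_assoc, hw', mul_inv_cancel₀ hz0]
      exact (eq_inv_of_mul_eq_one_left h1).symm
    have hmemO : (x - ι a)⁻¹ ∈ O := by
      rw [hϖinv]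
      exact mul_mem hzO (hL_O _ w.2)
    have h3 : Q.valuation (x - ι a)⁻¹ ≤ 1 := (O.valuation_le_one_iff _).2 hmemO
    rw [map_inv₀, inv_le_one₀ (by
      rw [Valuation.pos_iff]; exact hxa0)] at h3
    exact (not_lt.2 h3) hQx
  apply PlaceOver.ext
  exact le_antisymm (fun z hz => hO_V z hz) (fun z hz => hL_O z ((hVL z).1 hz))


/-! ### The place at a point with `∂Φ/∂X ≠ 0` -/

/-- **The place of a plane curve centred at a point with `∂Φ/∂X(a, b) ≠ 0`** — the statement of
`exists_place_of_derivative_ne_zero` with the roles of the variables exchanged (`∂Φ/∂X` is the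
`Y`-derivative of `swap Φ`; the hypothesis is now `y ≠ b`). [cite: Fulton2008, §3.2] -/
theorem exists_place_of_derivative_swap_ne_zero [IsAlgFunctionField K F] {x y : F} {Φ : K[X][Y]}
    (hΦ : (Φ.map (mapRingHom (algebraMap K F))).evalEval x y = 0)
    (hker : ∀ G : K[X][Y], (G.map (mapRingHom (algebraMap K F))).evalEval x y = 0 → Φ ∣ G)
    (hfrac : ∀ z : F, ∃ G H : K[X][Y], (H.map (mapRingHom (algebraMap K F))).evalEval x y ≠ 0 ∧
      z * (H.map (mapRingHom (algebraMap K F))).evalEval x y =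
        (G.map (mapRingHom (algebraMap K F))).evalEval x y)
    {a b : K} (hyb : y ≠ algebraMap K F b) (hab : Φ.evalEval a b = 0)
    (hder : (derivative (Bivariate.swap Φ)).evalEval b a ≠ 0) :
    ∃ P : PlaceOver K F, P.degree = 1 ∧ x ∈ P.toValuationSubring ∧ y ∈ P.toValuationSubring ∧
      P.valuation (x - algebraMap K F a) < 1 ∧ P.valuation (y - algebraMap K F b) < 1 ∧
      ∀ Q : PlaceOver K F, x ∈ Q.toValuationSubring → y ∈ Q.toValuationSubring →
        Q.valuation (x - algebraMap K F a) < 1 → Q.valuation (y - algebraMap K F b) < 1 → Q = P := by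
  have hΦ' : ((Bivariate.swap Φ).map (mapRingHom (algebraMap K F))).evalEval y x = 0 := by
    rw [evalEval_map_swap]; exact hΦ
  have hker' : ∀ G : K[X][Y], (G.map (mapRingHom (algebraMap K F))).evalEval y x = 0 →
      Bivariate.swap Φ ∣ G := by
    intro G hG
    rw [← Bivariate.swap_swap_apply G, evalEval_map_swap] at hG
    have h := map_dvd (Bivariate.swap (R := K)) (hker _ hG)
    rwa [Bivariate.swap_swap_apply] at h
  have hfrac' : ∀ z : F, ∃ G H : K[X][Y],
      (H.map (mapRingHom (algebraMap K F))).evalEval y x ≠ 0 ∧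
      z * (H.map (mapRingHom (algebraMap K F))).evalEval y x =
        (G.map (mapRingHom (algebraMap K F))).evalEval y x := by
    intro z
    obtain ⟨G, H, hH, hz⟩ := hfrac z
    refine ⟨Bivariate.swap G, Bivariate.swap H, ?_, ?_⟩
    · rwa [evalEval_map_swap]
    · rwa [evalEval_map_swap, evalEval_map_swap]
  have hab' : (Bivariate.swap Φ).evalEval b a = 0 := by rw [evalEval_swap_eq]; exact hab
  obtain ⟨P, hdeg, hyP, hxP, hvy, hvx, huniq⟩ :=
    exists_place_of_derivative_ne_zero hΦ' hker' hfrac' hyb hab' hder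
  exact ⟨P, hdeg, hxP, hyP, hvx, hvy, fun Q hxQ hyQ hQx hQy => huniq Q hyQ hxQ hQy hQx⟩

/-! ### The hypotheses in the model `F = K(X)[Y]/(Φ)` -/

section Model

/-! In this section the function field `L` lives in the same universe as `K` (as does the model
`AdjoinRoot`), which is what the lemmas of `PlaneCurveFunctionFieldProofs` require. -/

variable {L : Type u} [Field L] [Algebra K L] [Algebra K[X] L] [Algebra (RatFunc K) L]
  [IsScalarTower K[X] (RatFunc K) L] [IsScalarTower K K[X] L]

/-- In the model, `G(x, y) = aeval y (G ↦ K(X)[Y])`. [folklore] -/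
theorem evalEval_map_algebraMap_X_eq_aeval (G : K[X][Y]) (y : L) :
    (G.map (mapRingHom (algebraMap K L))).evalEval (algebraMap K[X] L X) y =
      aeval y (G.map (algebraMap K[X] (RatFunc K))) := by
  rw [← eval₂_eval₂RingHom_apply, eval₂RingHom_algebraMap_X, aeval_def, eval₂_map,
    ← algebraMap_polynomial_eq]

/-- **`Φ` generates the relations of `(x, y)`**: if `y` is a root of the monic `Φ` over `K(X)` with
minimal polynomial `Φ`, then `G(x, y) = 0` implies `Φ ∣ G` in `K[X][Y]` (Gauss's lemma).
[folklore] -/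
theorem dvd_of_evalEval_eq_zero {Φ : K[X][Y]} (hm : Φ.Monic) {y : L}
    (hmin : minpoly (RatFunc K) y = Φ.map (algebraMap K[X] (RatFunc K))) {G : K[X][Y]}
    (hG : (G.map (mapRingHom (algebraMap K L))).evalEval (algebraMap K[X] L X) y = 0) : Φ ∣ G := by
  rw [evalEval_map_algebraMap_X_eq_aeval] at hG
  have hdvd : Φ.map (algebraMap K[X] (RatFunc K)) ∣ G.map (algebraMap K[X] (RatFunc K)) := by
    rw [← hmin]; exact minpoly.dvd _ _ hG
  exact hm.isPrimitive.dvd_of_fraction_map_dvd_fraction_map hdvd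

/-- **Every element of `L = K(X)[y]` is a quotient `G(x, y)/c(x)`** with `c ∈ K[X]` nonzero
(clearing denominators), when `L` has a power basis generated by `y` over `K(X)`. [folklore] -/
theorem exists_mul_evalEval_eq (pb : PowerBasis (RatFunc K) L) (z : L) :
    ∃ G H : K[X][Y], (H.map (mapRingHom (algebraMap K L))).evalEval (algebraMap K[X] L X) pb.gen ≠ 0 ∧
      z * (H.map (mapRingHom (algebraMap K L))).evalEval (algebraMap K[X] L X) pb.gen =
        (G.map (mapRingHom (algebraMap K L))).evalEval (algebraMap K[X] L X) pb.gen := by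
  obtain ⟨p, rfl⟩ := pb.exists_eq_aeval' z
  obtain ⟨b, hb, hbp⟩ := IsLocalization.integerNormalization_spec (nonZeroDivisors K[X]) p
  refine ⟨IsLocalization.integerNormalization (nonZeroDivisors K[X]) p, C b, ?_, ?_⟩
  · rw [evalEval_map_algebraMap_X_eq_aeval, Polynomial.map_C, aeval_C,
      map_ne_zero_iff _ (algebraMap (RatFunc K) L).injective,
      map_ne_zero_iff _ (IsFractionRing.injective K[X] (RatFunc K))]
    exact nonZeroDivisors.ne_zero hb
  · rw [evalEval_map_algebraMap_X_eq_aeval, evalEval_map_algebraMap_X_eq_aeval, Polynomial.map_C,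
      aeval_C, hbp, ← algebraMap_smul (RatFunc K) b p, map_smul, Algebra.smul_def, mul_comm]

omit [Algebra K[X] L] [Algebra (RatFunc K) L] [IsScalarTower K[X] (RatFunc K) L]
  [IsScalarTower K K[X] L] in
/-- If `Φ(x, b) = 0` for a transcendental `x` (in the model: if `y = b` is a constant root) then
`∂Φ/∂X (a, b) = 0` for every `a`: the polynomial `Φ(X, b) ∈ K[X]` vanishes identically.
[folklore] -/
theorem evalEval_derivative_swap_eq_zero_of_transcendental {x : L} (hx : Transcendental K x)
    {Φ : K[X][Y]} {b : K}
    (hΦ : (Φ.map (mapRingHom (algebraMap K L))).evalEval x (algebraMap K L b) = 0) (a : K) :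
    (derivative (Bivariate.swap Φ)).evalEval b a = 0 := by
  -- `Φ(X, b) = 0` in `K[X]`
  have h1 : aeval x (Φ.eval (C b)) = 0 := by
    rw [evalEval, ← Polynomial.map_C (f := algebraMap K L), map_mapRingHom_eval_map,
      eval_map, ← aeval_def] at hΦ
    exact hΦ
  have h2 : Φ.eval (C b) = 0 := (transcendental_iff.1 hx) _ h1
  -- `Φ(X, b)` is also `swap Φ` with coefficients evaluated at `b`
  have h3 : (Bivariate.swap Φ).map (evalRingHom b) = Φ.eval (C b) := by
    have h : (mapRingHom (evalRingHom b)).comp (Bivariate.swap (R := K) : K[X][Y] →+* K[X][Y]) =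
        evalRingHom (C b) := by
      refine Polynomial.ringHom_ext (fun q => ?_) ?_
      · rw [RingHom.comp_apply, RingHom.coe_coe, Bivariate.swap_C, coe_mapRingHom,
          Polynomial.map_map, coe_evalRingHom, eval_C]
        have hc : (evalRingHom b).comp C = RingHom.id K := by
          ext c
          simp
        rw [hc, Polynomial.map_id]
      · rw [RingHom.comp_apply, RingHom.coe_coe, Bivariate.swap_Y, coe_mapRingHom, Polynomial.map_C,
          coe_evalRingHom, eval_X, coe_evalRingHom, eval_X]
    exact congr($h Φ)
  rw [← map_evalRingHom_eval, ← Polynomial.derivative_map, h3, h2, derivative_zero, eval_zero]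

/-- The image `x` of `X` differs from every constant. [folklore] -/
theorem algebraMap_X_ne_algebraMap (a : K) : algebraMap K[X] L X ≠ algebraMap K L a := fun h =>
  transcendental_algebraMap_X K L (by rw [h]; exact isAlgebraic_algebraMap a)

/-- **Places centred at a nonsingular rational point of a plane curve.** In the function field
`L = K(X)[Y]/(Φ)` of the irreducible plane curve `Φ = 0` (`Φ` monic in `Y`, `y = pb.gen` a root with
minimal polynomial `Φ` over `K(X)`, `x` the image of `X`), let `(a, b) ∈ K²` be a point of the curve
at which `∂Φ/∂Y` or `∂Φ/∂X` does not vanish. Then there is exactly one place `P` of `L/K` centred at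
`(a, b)` (`x, y ∈ 𝒪_P`, `v_P(x - a) > 0`, `v_P(y - b) > 0`), and it has degree one.
[cite: Fulton2008, §3.2] [cite: Stichtenoth2009, Thm. 3.3.7 (proof)] -/
theorem exists_place_of_nonsingular [IsAlgFunctionField K L] {Φ : K[X][Y]} (hm : Φ.Monic)
    (pb : PowerBasis (RatFunc K) L)
    (hmin : minpoly (RatFunc K) pb.gen = Φ.map (algebraMap K[X] (RatFunc K))) {a b : K}
    (hab : Φ.evalEval a b = 0)
    (hns : (derivative Φ).evalEval a b ≠ 0 ∨ (derivative (Bivariate.swap Φ)).evalEval b a ≠ 0) :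
    ∃ P : PlaceOver K L, P.degree = 1 ∧ algebraMap K[X] L X ∈ P.toValuationSubring ∧
      pb.gen ∈ P.toValuationSubring ∧
      P.valuation (algebraMap K[X] L X - algebraMap K L a) < 1 ∧
      P.valuation (pb.gen - algebraMap K L b) < 1 ∧
      ∀ Q : PlaceOver K L, algebraMap K[X] L X ∈ Q.toValuationSubring →
        pb.gen ∈ Q.toValuationSubring →
        Q.valuation (algebraMap K[X] L X - algebraMap K L a) < 1 →
        Q.valuation (pb.gen - algebraMap K L b) < 1 → Q = P := by
  have hxt : Transcendental K (algebraMap K[X] L X) := transcendental_algebraMap_X K L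
  have hΦy : aeval pb.gen (Φ.map (algebraMap K[X] (RatFunc K))) = 0 := by
    rw [← hmin]; exact minpoly.aeval _ _
  have hΦ : (Φ.map (mapRingHom (algebraMap K L))).evalEval (algebraMap K[X] L X) pb.gen = 0 := by
    rw [evalEval_map_algebraMap_X_eq_aeval]; exact hΦy
  have hker : ∀ G : K[X][Y],
      (G.map (mapRingHom (algebraMap K L))).evalEval (algebraMap K[X] L X) pb.gen = 0 → Φ ∣ G :=
    fun G hG => dvd_of_evalEval_eq_zero hm hmin hG
  have hfrac := exists_mul_evalEval_eq (K := K) pb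
  have hxa : algebraMap K[X] L X ≠ algebraMap K L a := algebraMap_X_ne_algebraMap a
  rcases hns with hder | hder
  · exact exists_place_of_derivative_ne_zero hΦ hker hfrac hxa hab hder
  · have hyb : pb.gen ≠ algebraMap K L b := by
      intro h
      apply hder
      rw [h] at hΦ
      exact evalEval_derivative_swap_eq_zero_of_transcendental hxt hΦ a
    exact exists_place_of_derivative_swap_ne_zero hΦ hker hfrac hyb hab hder

end Model

end Literature.NumberTheory.DiophantineGeometry.AlgFunctionField

end
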